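import Mathlib
import Summits.ValiantsHypothesis.ValiantsHypothesis.Theses.ProofCarryingSymmetry
import Summits.ValiantsHypothesis.ValiantsHypothesis.Theorems.ProofCarryingSymmetryRestorationQPVpFamilyPiCircuit
import Summits.ValiantsHypothesis.ValiantsHypothesis.Theorems.ProofCarryingSymmetryRestorationQPDistStability
import Summits.ValiantsHypothesis.ValiantsHypothesis.Theorems.ProofCarryingSymmetryRestorationQPPiCircuitVpFamily
import Summits.ValiantsHypothesis.ValiantsHypothesis.Theorems.ProofCarryingSymmetryPerLineAssembly
import Summits.ValiantsHypothesis.ValiantsHypothesis.Theorems.RestorationQP.Negative.RestorationQPFalseOfArithmeticCFI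

/-!
# Route ProofCarryingSymmetry, crux `RestorationQP` — the line's composition as an importable theorem

Lead c3.  The kernel-checked composition of line `registered` (`Cruxes/RestorationQP/Lines/birth.lean`,
`RestorationQP_of`) lives in a crux WORKFILE (with the two open stubs as `sorry`s) and is therefore not
importable.  For the planner's TWO-LAYER PLAN (b) — file the two open stubs as items T_gen := T′ and
L := S2⁗ and let the crux close by composition — this file lands the composition at `Theorems/` level,
with the two stub statements as HYPOTHESES (verbatim the registered signatures):

* `restorationQP_of_invarianceProvableQP'_of_proofsToDistEquiv : T′ → S2⁗ → RestorationQP`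
  (W1 `stub_vpFamily_piCircuit`, p145664, and S3⁗ `stabilityAtDistEquiv`, p157844, discharged inside;
  quasi-polynomial bookkeeping `qp_absorb_two` of the per-line assembly);
* `restorationQP_iff_invarianceProvableQP'_of_proofsToDistEquiv : S2⁗ → (RestorationQP ↔ T′)` — given the
  bet, the crux is EQUIVALENT to its provability half (necessity `invarianceProvableQP'_of_restorationQP`,
  p157625);
* `invarianceProvableQP'_false_of_arithmeticCFI_of_proofsToDistEquiv : ArithmeticCFI → S2⁗ → ¬T′` — in the
  world of the bet an arithmetic CFI family (p162481) also kills the provability stub.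

Everything proved; no new definitions.
-/

-- single-problem summit: `Summit.ValiantsHypothesis.ValiantsHypothesis.…` is the namespace by design (D-0017)
set_option linter.dupNamespace false

namespace Summit.ValiantsHypothesis.ValiantsHypothesis.Theorems

open Literature.Computability.AlgebraicComplexity


/-- **T′ → S2⁗ → RestorationQP** — the composition of line `registered` at `Theorems/` level, with the two
open (conjecture-grade) registered stubs as hypotheses, verbatim: T′ (`stub_invarianceProvableQP'`:
quasi-polynomial proof-carrying circuits for every invariant family with polynomial-size `PICircuit`s and
polynomial degree) and S2⁗ (`stub_proofsToDistEquiv`: distributivity elimination from invariance proofs at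
polynomial cost, the bet ≡ L).  Proof: a VP family has polynomial-size `PICircuit`s and polynomial degree
(W1 `stub_vpFamily_piCircuit`); T′ gives quasi-polynomial circuits with quasi-polynomial invariance proofs;
S2⁗ trades the proofs for a polynomially larger circuit with distributivity-free renamed unfoldings; S3⁗
(`stabilityAtDistEquiv`) turns that into an `S_n`-symmetric circuit; exponents are absorbed
(`ACStability.poly_absorb'`, `qp_absorb_two`). [folklore] -/
theorem restorationQP_of_invarianceProvableQP'_of_proofsToDistEquiv :
    (∀ f : (n : ℕ) → MvPolynomial (Fin n × Fin n) ℂ,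
      (∀ (n : ℕ) (σ : Equiv.Perm (Fin n)),
        MvPolynomial.rename (fun x : Fin n × Fin n => σ • x) (f n) = f n) →
      (∃ c : ℕ, ∀ n : ℕ, (f n).totalDegree ≤ (n + 2) ^ c ∧
        ∃ C : PICircuit ℂ (Fin n × Fin n), C.eval = f n ∧ C.size ≤ (n + 2) ^ c) →
      ∃ c : ℕ, ∀ n : ℕ, ∃ C : PICircuit ℂ (Fin n × Fin n),
        C.eval = f n ∧ C.size ≤ 2 ^ ((Nat.log 2 n + c) ^ c) ∧
        ∀ σ : Equiv.Perm (Fin n),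
          HasPCProofOfSize (C.rename fun x : Fin n × Fin n => σ • x) C
            (2 ^ ((Nat.log 2 n + c) ^ c))) →
    (∃ c : ℕ, ∀ (n t : ℕ) (C : PICircuit ℂ (Fin n × Fin n)),
      (∀ σ : Equiv.Perm (Fin n),
        HasPCProofOfSize (C.rename fun x : Fin n × Fin n => σ • x) C t) →
      ∃ C' : PICircuit ℂ (Fin n × Fin n), C'.eval = C.eval ∧
        C'.size ≤ (C.size + t + n + 2) ^ c ∧
        ∀ σ : Equiv.Perm (Fin n),
          (pfSystem ℂ (Fin n × Fin n)).Provable (C'.rename fun x : Fin n × Fin n => σ • x).unfold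
            C'.unfold ⊤ (fun s => if s = PIAxiom.A6 then 0 else ⊤)) →
    Summit.ValiantsHypothesis.ValiantsHypothesis.Theses.ProofCarryingSymmetry.RestorationQP := by
  intro hT hS2
  unfold Summit.ValiantsHypothesis.ValiantsHypothesis.Theses.ProofCarryingSymmetry.RestorationQP
  intro f hinv hVP
  -- T_gen = W1 ∘ T′
  obtain ⟨c₁, hc₁⟩ := hT f hinv (stub_vpFamily_piCircuit f hVP)
  -- L = S2⁗ ∘ S3⁗ with exponent `(c₂ + 2) c₃`
  obtain ⟨c₂, h₂⟩ := hS2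
  obtain ⟨c₃, h₃⟩ := stabilityAtDistEquiv
  obtain ⟨c, hc⟩ := qp_absorb_two c₁ ((c₂ + 2) * c₃)
  refine ⟨c, fun n => ?_⟩
  obtain ⟨C, hCeval, hCsize, hCproofs⟩ := hc₁ n
  obtain ⟨C', hC'eval, hC'size, hC'pf⟩ := h₂ n (2 ^ ((Nat.log 2 n + c₁) ^ c₁)) C hCproofs
  obtain ⟨G, hG, D, hDsym, hDeval, hDcard⟩ := h₃ n C' hC'pf
  refine ⟨G, hG, D, hDsym, ?_, ?_⟩
  · rw [hDeval, hC'eval, hCeval]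
  · calc Fintype.card G ≤ (C'.size + n + 2) ^ c₃ := hDcard
      _ ≤ ((C.size + 2 ^ ((Nat.log 2 n + c₁) ^ c₁) + n + 2) ^ c₂ + n + 2) ^ c₃ :=
          Nat.pow_le_pow_left (by omega) _
      _ ≤ (C.size + 2 ^ ((Nat.log 2 n + c₁) ^ c₁) + n + 2) ^ ((c₂ + 2) * c₃) :=
          ACStability.poly_absorb' c₂ c₃ _ _ n C.one_le_size
      _ ≤ (2 ^ ((Nat.log 2 n + c₁) ^ c₁) + 2 ^ ((Nat.log 2 n + c₁) ^ c₁) + n + 2) ^ ((c₂ + 2) * c₃) :=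
          Nat.pow_le_pow_left (by omega) _
      _ ≤ 2 ^ ((Nat.log 2 n + c) ^ c) := hc n

/-- **Given the bet, the crux is EQUIVALENT to its provability half**: S2⁗ → (RestorationQP ↔ T′)
(⇐ by the composition above; ⇒ by necessity `invarianceProvableQP'_of_restorationQP`, p157625). [folklore] -/
theorem restorationQP_iff_invarianceProvableQP'_of_proofsToDistEquiv :
    (∃ c : ℕ, ∀ (n t : ℕ) (C : PICircuit ℂ (Fin n × Fin n)),
      (∀ σ : Equiv.Perm (Fin n),
        HasPCProofOfSize (C.rename fun x : Fin n × Fin n => σ • x) C t) →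
      ∃ C' : PICircuit ℂ (Fin n × Fin n), C'.eval = C.eval ∧
        C'.size ≤ (C.size + t + n + 2) ^ c ∧
        ∀ σ : Equiv.Perm (Fin n),
          (pfSystem ℂ (Fin n × Fin n)).Provable (C'.rename fun x : Fin n × Fin n => σ • x).unfold
            C'.unfold ⊤ (fun s => if s = PIAxiom.A6 then 0 else ⊤)) →
    (Summit.ValiantsHypothesis.ValiantsHypothesis.Theses.ProofCarryingSymmetry.RestorationQP ↔
      ∀ f : (n : ℕ) → MvPolynomial (Fin n × Fin n) ℂ,
        (∀ (n : ℕ) (σ : Equiv.Perm (Fin n)),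
          MvPolynomial.rename (fun x : Fin n × Fin n => σ • x) (f n) = f n) →
        (∃ c : ℕ, ∀ n : ℕ, (f n).totalDegree ≤ (n + 2) ^ c ∧
          ∃ C : PICircuit ℂ (Fin n × Fin n), C.eval = f n ∧ C.size ≤ (n + 2) ^ c) →
        ∃ c : ℕ, ∀ n : ℕ, ∃ C : PICircuit ℂ (Fin n × Fin n),
          C.eval = f n ∧ C.size ≤ 2 ^ ((Nat.log 2 n + c) ^ c) ∧
          ∀ σ : Equiv.Perm (Fin n),
            HasPCProofOfSize (C.rename fun x : Fin n × Fin n => σ • x) C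
              (2 ^ ((Nat.log 2 n + c) ^ c))) :=
  fun hS2 => ⟨fun hR => invarianceProvableQP'_of_restorationQP hR,
    fun hT => restorationQP_of_invarianceProvableQP'_of_proofsToDistEquiv hT hS2⟩

/-- **In the world of the bet, an arithmetic CFI family also kills the provability stub**:
`ArithmeticCFI → S2⁗ → ¬T′` (the composition and `RestorationQP_false_of_ArithmeticCFI`, p162481). [folklore] -/
theorem invarianceProvableQP'_false_of_arithmeticCFI_of_proofsToDistEquiv :
    ArithmeticCFI →
    (∃ c : ℕ, ∀ (n t : ℕ) (C : PICircuit ℂ (Fin n × Fin n)),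
      (∀ σ : Equiv.Perm (Fin n),
        HasPCProofOfSize (C.rename fun x : Fin n × Fin n => σ • x) C t) →
      ∃ C' : PICircuit ℂ (Fin n × Fin n), C'.eval = C.eval ∧
        C'.size ≤ (C.size + t + n + 2) ^ c ∧
        ∀ σ : Equiv.Perm (Fin n),
          (pfSystem ℂ (Fin n × Fin n)).Provable (C'.rename fun x : Fin n × Fin n => σ • x).unfold
            C'.unfold ⊤ (fun s => if s = PIAxiom.A6 then 0 else ⊤)) →
    ¬ ∀ f : (n : ℕ) → MvPolynomial (Fin n × Fin n) ℂ,
        (∀ (n : ℕ) (σ : Equiv.Perm (Fin n)),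
          MvPolynomial.rename (fun x : Fin n × Fin n => σ • x) (f n) = f n) →
        (∃ c : ℕ, ∀ n : ℕ, (f n).totalDegree ≤ (n + 2) ^ c ∧
          ∃ C : PICircuit ℂ (Fin n × Fin n), C.eval = f n ∧ C.size ≤ (n + 2) ^ c) →
        ∃ c : ℕ, ∀ n : ℕ, ∃ C : PICircuit ℂ (Fin n × Fin n),
          C.eval = f n ∧ C.size ≤ 2 ^ ((Nat.log 2 n + c) ^ c) ∧
          ∀ σ : Equiv.Perm (Fin n),
            HasPCProofOfSize (C.rename fun x : Fin n × Fin n => σ • x) C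
              (2 ^ ((Nat.log 2 n + c) ^ c)) :=
  fun hA hS2 hT => RestorationQP_false_of_ArithmeticCFI hA
    (restorationQP_of_invarianceProvableQP'_of_proofsToDistEquiv hT hS2)

end Summit.ValiantsHypothesis.ValiantsHypothesis.Theorems
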